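import Summits.QuantumAdvantage.QuantumAdvantage.Theorems.SparsityDialMP14

/-!
# SparsityDial — part MP15 of 15 of the «MovingPointers» package (decomp-qadv lens 2, g18): §K the local ladder in piece S's shape — `LocalHashTableLossSG3 w` (below `SparseGenericLoss3` by name; `w = 0` PROVED)

Imports its predecessor `SparsityDialMP14` (linear chain MP1 → … → MP15); the package overview is the module docstring of `SparsityDialMP1`.
This part: `LocalHashTableLossSG3 w` = the range-`w` table rung in the gauge-existential shape of piece S; `localSG_of_sparse w :
SparseGenericLoss3 → LocalHashTableLossSG3 w` for EVERY `w` (a literal consequence of S), monotone in `w`, and `w = 0` PROVED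
(`localHashTableLossSG3_zero`, from the affine-table S-form of part MP11 via `local0_affine` of part MP14).
No `sorry`; standard axioms; no instances / notation.
-/

set_option linter.unusedVariables false
set_option linter.dupNamespace false

noncomputable section
open scoped Classical

namespace Summit.QuantumAdvantage.QuantumAdvantage.Theorems.SparsityDial

open Finset
open Literature.Computability.QuantumComplexity Literature.Computability.QuantumComplexity.RingHLF
open Literature.Computability.MetaComplexity Literature.Computability.MetaComplexity.Smolensky
open Summit.QuantumAdvantage.AdviceFreeQNC0
open Summit.QuantumAdvantage.QuantumAdvantage.Theorems.HolonomyDial (gCond)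
open Summit.QuantumAdvantage.QuantumAdvantage.Theorems.LocusDial
open Summit.QuantumAdvantage.QuantumAdvantage.Theorems.AnchorDial (dev outB win_iff card_odd_ge)
open Summit.QuantumAdvantage.QuantumAdvantage.Theorems.HolonomyDial (card_odd_le)
open Summit.QuantumAdvantage.QuantumAdvantage.Theorems.StabilizerDial (eventually_polylog StabFew stabFew_of_fewLocus)

/-! ## §K  The local ladder in piece S's own shape: `LocalHashTableLossSG3 w` — BELOW S BY NAME for every `w`; `w = 0` PROVED -/

section LocalS
variable {N : ℕ}

open Summit.QuantumAdvantage.QuantumAdvantage.Theorems.StabilizerDial (pad winset_pad)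

/-- **`LocalHashTableLossSG3 w`** — the range-`w` rung in piece S's own gauge-existential shape (`∀ c, ∃ C`; `P` of degree
`≤ (log₂ n)^c`, essentially nonlocal `¬ StabFew 1 0 (c+1) P`; admissible gauge of degree `≤ (log₂ n)^{c+1}`).  For EVERY `w` it is
LITERALLY a consequence of S (`localSG_of_sparse`) — so it is a genuine rung of item 27655: proving S entails it, refuting it for
any `w` refutes S — and `w = 0` is PROVED (`localHashTableLossSG3_zero`); `w = 1` is the named next rung. -/
def LocalHashTableLossSG3 (w : ℕ) : Prop := ∀ c : ℕ, ∃ C : ℕ, ∃ n₀ : ℕ, ∀ n ≥ n₀, ∀ t ≤ (Nat.log 2 n) ^ c,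
  ∀ (h : Fin t → CubeFn (ZMod 3) n) (S : (Fin t → ZMod 3) → Finset (Fin n)),
    (∀ r, IsLocalHash w (h r)) → (∀ v, (S v).card ≤ (Nat.log 2 n) ^ c) →
    ∀ P : Fin n → CubeFn (ZMod 3) n, (∀ i, P i ∈ lowDeg (ZMod 3) n ((Nat.log 2 n) ^ c)) →
      ¬ StabFew 1 0 (c + 1) P →
      (∃ s : Fin n → CubeFn (ZMod 3) n, (∀ i, s i ∈ lowDeg (ZMod 3) n ((Nat.log 2 n) ^ (c + 1))) ∧
        ∀ x, OddZeros x → dev (pad P s) x = S (fun r => h r x)) →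
      ((univ.filter fun x : Fin n → Bool => OddZeros x ∧ Rel x (fun i => decide (P i x = 1))).card : ℝ) ≤
        (1 - 1 / (n : ℝ) ^ C) * (2 : ℝ) ^ (n - 1)

/-- **below S by name, for every range `w`**: the gauge in the hypothesis witnesses `StabFew ((log₂ n)^c) 0 (c+1) P` (the table values
have size `≤ (log₂ n)^c`), so piece S applies verbatim — locality is not even used. -/
theorem localSG_of_sparse (w : ℕ) (hS : SparseGenericLoss3) : LocalHashTableLossSG3 w := by
  intro c
  obtain ⟨C, hC⟩ := hS c
  obtain ⟨n₀, hn₀⟩ := hC c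
  refine ⟨C, n₀, fun n hn t _ h S _ hcard P hP hgen hs => ?_⟩
  obtain ⟨s, hsdeg, hdev⟩ := hs
  refine hn₀ n hn P hP ⟨s, hsdeg, fewLocus_of_dev_card (pad P s) fun x hx => ?_⟩ hgen
  rw [hdev x hx]
  exact hcard _

/-- the S-shape ladder is monotone in the range too. -/
theorem localHashTableLossSG3_anti {w w' : ℕ} (hw : w ≤ w') (h : LocalHashTableLossSG3 w') : LocalHashTableLossSG3 w := by
  intro c
  obtain ⟨C, n₀, hn₀⟩ := h c
  exact ⟨C, n₀, fun n hn t ht hh S hl hcard P hP hgen hs =>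
    hn₀ n hn t ht hh S (fun r => (hl r).mono hw) hcard P hP hgen hs⟩

/-- S-shape range `0` from the affine-table S-form (constant shift absorbed into the table). -/
theorem localSG0_of_tableSG (hT : AffineTableLossSG3) : LocalHashTableLossSG3 0 := by
  intro c
  obtain ⟨C, n₀, hn₀⟩ := hT c
  refine ⟨C, n₀, fun n hn t ht h S hl hcard P hP hgen hs => ?_⟩
  choose m β hmβ using fun r => local0_affine (hl r)
  obtain ⟨s, hsdeg, hdev⟩ := hs
  refine hn₀ n hn t ht (fun r i => m r i) (fun v => S (fun r => v r + β r)) (fun v => hcard _) P hP hgen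
    ⟨s, hsdeg, fun x hx => ?_⟩
  rw [hdev x hx]
  congr 1
  funext r
  rw [hmβ r x]
  rfl

/-- **rung `w = 0` of the S-shape ladder PROVED.** -/
theorem localHashTableLossSG3_zero : LocalHashTableLossSG3 0 := localSG0_of_tableSG affineTableLossSG3

end LocalS

/-- info: 'Summit.QuantumAdvantage.QuantumAdvantage.Theorems.SparsityDial.localHashTableLossSG3_zero' depends on axioms: [propext,
 Classical.choice,
 Quot.sound] -/
#guard_msgs in #print axioms localHashTableLossSG3_zero

/-- info: 'Summit.QuantumAdvantage.QuantumAdvantage.Theorems.SparsityDial.localSG_of_sparse' depends on axioms: [propext,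
 Classical.choice,
 Quot.sound] -/
#guard_msgs in #print axioms localSG_of_sparse



end Summit.QuantumAdvantage.QuantumAdvantage.Theorems.SparsityDial
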